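import Summits.Ventures.LatticeQCDFlow.Scaling.ReplicaExchangeFrozenCold
import Summits.Ventures.LatticeQCDFlow.Scaling.SimulatedTemperingTunnelingTime

/-!
HONEST FRAMING: exact (Metropolis-corrected) sampling algorithms for lattice gauge theory; figures
of merit are autocorrelation/cost numbers at stated couplings and volumes; no continuum-physics
claim.

# ReplicaExchangeTunnelingTime — THE EQUILIBRIUM TIME UNTIL THE REPLICA AT LEVEL `k` SITS IN SECTOR `j` UNDER THE
# TAGLESS REPLICA-EXCHANGE SAMPLER IS AT MOST `(1 − ν_k(j))/(c·ν_k(j))`, `c` THE CHAPTER-R GAP FLOOR — TUNNELLING OF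
# THE COLD REPLICA IS IMPORTED FROM THE HOT ONE IN POLYNOMIAL TIME (lean-2 GEN-18, ours)

Venture-side (OURS).  Cell `lqcd-flow` (pub-lqcd), unit `pub-lqcd-lean-2-g18`, 2026-08-25.  Chapter R, file 8 — the
positive counterpart of the metastability bounds `Scaling/SectorExitProbability` / `…SectorHitting` (GEN-17): the
generic ceiling `Scaling/EquilibriumExitCeiling` (`Σ_x π(x)E_x(τ_A ∧ N) ≤ π(Aᶜ)/(γπ(A))`, any Poincaré constant `γ`)
(its simulated-tempering twin is `Scaling/SimulatedTemperingTunnelingTime`) applied to `P = ptBareSampler ½ μ M` with `A = {x : mode(x_k) = j}` ("the replica at level `k` is in sector `j`",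
mass `ν_k(j) = μ_k(A_j)`) and the gap floors of `Scaling/ReplicaExchangeModeGap` (within-mode gaps, hot gap between
modes, overlaps, persistence) or `Scaling/ReplicaExchangeFrozenCold` (arbitrary cold updates).

## What is proved

* §1 `ptBare_levelSector_mass` — `π̃{mode(x_k) = j} = ν_k(j)` (the Poincaré form of the gap is
  `Literature…SpectralGapVariational.LevinPeres2017_remark_13_8`, re-exported through E3).
* §2 **`ptBareFrozen_tunnelingTime_le`** — with an irreducible hot update of Poincaré constant `γ₀`, ARBITRARY
  reversible cold updates and pointwise two-sided persistence `p, q`: for every level `k`, sector `j`, horizon `N`,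
  `Σ_x π̃(x)·E_x(τ_{mode(x_k)=j} ∧ N) ≤ (1 − μ_k(A_j))·96(K+1)²/(pq^K·min{1/K², γ₀/(K+1)}·μ_k(A_j))`.
* §3 **`ptBareMode_tunnelingTime_le`** — the same with the chapter-R floor `pq^Kγ_A·min{δ₂/K², γ₀/(K+1)}/(96(K+1)²)`
  (within-mode gaps `γ_A`, hot global gap `γ₀`, assignment-restricted swap overlaps `δ₂`; irreducibility not needed).

Reading (no numerics implied): started from equilibrium, the expected number of steps before the COLD replica (or
any replica) is found in a prescribed topological sector is polynomial in the number of replicas and inversely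
proportional to the sector's weight at that level and to `pq^K` — however metastable the cold dynamics is.  NOT
CLAIMED: pointwise (worst-case) starts; tail bounds; anything measured.  Literature grade (cell rule): KNOWN MECHANISM
(mean hitting times vs relaxation time, Aldous–Fill Ch. 3), NEW TYPING; nothing cited as a fact; no new bib keys.
-/

noncomputable section

open Finset Function
open Literature.Probability.MarkovChains
open Literature.Probability.MarkovChains.Decomposition

namespace Summit.Ventures.LatticeQCDFlow.Scaling

/-! ## §1 The mass of a level–sector event -/

section Tunnel

variable {S J : Type*} [Fintype S] [DecidableEq S] [Fintype J] [DecidableEq J] {K : ℕ}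
  {μ : Fin (K + 1) → S → ℝ} {M : Fin (K + 1) → S → S → ℝ} {mode : S → J}

omit [DecidableEq S] [Fintype J] in
/-- **`π̃{x : mode(x_k) = j} = μ_k(A_j)`** (one-coordinate marginal of the product law). [ours] -/
theorem ptBare_levelSector_mass (hμ1 : ∀ k, ∑ x, μ k x = 1) (k : Fin (K + 1)) (j : J) :
    ∑ x ∈ univ.filter (fun x : Fin (K + 1) → S => mode (x k) = j), tensorFun μ x = blockMass (μ k) mode j := by
  rw [sum_filter]
  have e : ∀ x : Fin (K + 1) → S, (if mode (x k) = j then tensorFun μ x else 0)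
      = tensorFun μ x * (if mode (x k) = j then 1 else 0) := fun x => by split_ifs <;> simp
  simp_rw [e]
  rw [sum_tensorFun_mul_apply μ hμ1 k (fun u => if mode u = j then (1 : ℝ) else 0)]
  unfold blockMass block
  rw [sum_filter]
  exact sum_congr rfl fun u _ => by split_ifs <;> simp

omit [Fintype J] in
/-- The complement mass: `π̃{mode(x_k) ≠ j} = 1 − μ_k(A_j)`. [ours] -/
theorem ptBare_levelSector_mass_compl (hμ1 : ∀ k, ∑ x, μ k x = 1) (k : Fin (K + 1)) (j : J) :
    ∑ x ∈ (univ.filter (fun x : Fin (K + 1) → S => mode (x k) = j))ᶜ, tensorFun μ x = 1 - blockMass (μ k) mode j := by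
  rw [← ptBare_levelSector_mass hμ1 k j, ← sum_tensorFun_eq_one μ hμ1,
    ← sum_add_sum_compl (univ.filter (fun x : Fin (K + 1) → S => mode (x k) = j))]
  ring

/-! ## §2 Arbitrary cold updates -/

omit [Fintype J] in
/-- **TUNNELLING-TIME CEILING WITH ARBITRARY COLD UPDATES.**  Irreducible hot update with Poincaré constant `γ₀`,
arbitrary reversible cold updates, pointwise persistence `p` and cooling `q` (`p, q ≤ 1`, `K ≥ 1`): for every level
`k`, every target set of configurations `A_j = {mode = j}` and every horizon `N`,
`Σ_x π̃(x)·E_x(τ_{mode(x_k) = j} ∧ N) ≤ (1 − μ_k(A_j))/(c·μ_k(A_j))`, `c = pq^K·min{1/K², γ₀/(K+1)}/(96(K+1)²)`. [ours] -/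
theorem ptBareFrozen_tunnelingTime_le [Nontrivial S] (hK : 1 ≤ K) (hμ : ∀ k x, 0 < μ k x)
    (hμ1 : ∀ k, ∑ x, μ k x = 1) (hM : ∀ k, IsRowStochastic (M k)) (hMrev : ∀ k, DetailedBalance (μ k) (M k))
    {p q γ₀ : ℝ} (hp : 0 < p) (hp1 : p ≤ 1) (hq0 : 0 < q) (hq1 : q ≤ 1) (hγ₀ : 0 < γ₀)
    (hpers : ∀ (i k : Fin (K + 1)) (x : S), i ≤ k → p * μ k x ≤ μ i x)
    (hq : ∀ (l : Fin K) (x : S), q * μ l.castSucc x ≤ μ l.succ x)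
    (hgap0 : ∀ h : S → ℝ, γ₀ * lawVariance (μ 0) h ≤ dirichletForm (μ 0) (M 0) h)
    (hmode : Function.Surjective mode) (k : Fin (K + 1)) (j : J) (N : ℕ) :
    ∑ x, tensorFun μ x * meanHitWithin (ptBareSampler (1 / 2) μ M)
        (↑(univ.filter (fun x : Fin (K + 1) → S => mode (x k) = j)) : Set (Fin (K + 1) → S)) N x
      ≤ (1 - blockMass (μ k) mode j)
          / (p * q ^ K * min (1 / (K : ℝ) ^ 2) (γ₀ / (K + 1)) / (96 * (K + 1) ^ 2) * blockMass (μ k) mode j) := by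
  have ht0 : (0 : ℝ) < 1 / 2 := by norm_num
  have ht1 : (1 / 2 : ℝ) < 1 := by norm_num
  have hKr : (1 : ℝ) ≤ K := by exact_mod_cast hK
  have hP := ptBareSampler_isRowStochastic (M := M) hμ hM ht0.le ht1.le
  have hDB := ptBareSampler_detailedBalance (t := (1 / 2 : ℝ)) (M := M) hμ hMrev
  have hst := ptBareSampler_isStationary (t := (1 / 2 : ℝ)) hμ hM hMrev ht0.le ht1.le
  set c := p * q ^ K * min (1 / (K : ℝ) ^ 2) (γ₀ / (K + 1)) / (96 * (K + 1) ^ 2) with hcdef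
  have hm : 0 < min (1 / (K : ℝ) ^ 2) (γ₀ / (K + 1)) := lt_min (by positivity) (div_pos hγ₀ (by positivity))
  have hcpos : 0 < c := by positivity
  have hc : c ≤ spectralGap (tensorFun μ) (ptBareSampler (1 / 2) μ M) :=
    ptBareFrozen_spectralGap_ge hK hμ hμ1 hM hMrev hp hp1 hq0 hq1 hγ₀ hpers hq hgap0
  have hgap : ∀ f : (Fin (K + 1) → S) → ℝ,
      c * lawVariance (tensorFun μ) f ≤ dirichletForm (tensorFun μ) (ptBareSampler (1 / 2) μ M) f := fun f =>
    (mul_le_mul_of_nonneg_right hc (lawVariance_nonneg (fun x => (tensorFun_pos hμ x).le) f)).trans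
      (LevinPeres2017_remark_13_8 (tensorFun_pos hμ) (sum_tensorFun_eq_one μ hμ1) hP hDB f)
  have hA : 0 < ∑ x ∈ univ.filter (fun x : Fin (K + 1) → S => mode (x k) = j), tensorFun μ x := by
    rw [ptBare_levelSector_mass hμ1 k j]; exact blockMass_pos (hμ k) hmode j
  have h := equilibrium_meanHitWithin_le (fun x => (tensorFun_pos hμ x).le) (sum_tensorFun_eq_one μ hμ1) hP hst hcpos
    hgap _ hA N
  rw [ptBare_levelSector_mass hμ1 k j] at h
  rw [ptBare_levelSector_mass_compl hμ1 k j] at h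
  exact h

/-! ## §3 Modes with within-mode gaps -/

/-- **TUNNELLING-TIME CEILING FROM THE CHAPTER-R FLOOR.**  Reversible replica updates with within-mode
Poincaré constant `γ_A`, the hot update's global gap `γ₀`, assignment-restricted swap overlaps `δ₂`, persistence `p`,
cooling `q`: `Σ_x π̃(x)·E_x(τ_{mode(x_k) = j} ∧ N) ≤ (1 − μ_k(A_j))/(c·μ_k(A_j))`,
`c = pq^Kγ_A·min{δ₂/K², γ₀/(K+1)}/(96(K+1)²)`. [ours] -/
theorem ptBareMode_tunnelingTime_le [Nontrivial S] (hK : 1 ≤ K) (hμ : ∀ k x, 0 < μ k x)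
    (hμ1 : ∀ k, ∑ x, μ k x = 1) (hmode : Function.Surjective mode) (hM : ∀ k, IsRowStochastic (M k))
    (hMrev : ∀ k, DetailedBalance (μ k) (M k))
    {p q δ₂ γ₀ γA : ℝ} (hp : 0 < p) (hp1 : p ≤ 1) (hq0 : 0 < q) (hq1 : q ≤ 1) (hδ0 : 0 < δ₂) (hδ1 : δ₂ ≤ 1)
    (hγ₀ : 0 < γ₀) (hγA : 0 < γA) (hγA1 : γA ≤ 1)
    (hpers : ∀ (i k : Fin (K + 1)) (j : J), i ≤ k → p * blockMass (μ k) mode j ≤ blockMass (μ i) mode j)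
    (hq : ∀ (l : Fin K) (j : J), q * blockMass (μ l.castSucc) mode j ≤ blockMass (μ l.succ) mode j)
    (hδ : ∀ (m : Fin (K + 1) → J) (l : Fin K), m ∘ levelSwap l ≠ m →
      δ₂ * min (blockMass (tensorFun μ) (fun z : Fin (K + 1) → S => mode ∘ z) m)
          (blockMass (tensorFun μ) (fun z : Fin (K + 1) → S => mode ∘ z) (m ∘ levelSwap l))
        ≤ ∑ x ∈ block (fun z : Fin (K + 1) → S => mode ∘ z) m, min (tensorFun μ x) (tensorFun μ (x ∘ levelSwap l)))
    (hgap0 : ∀ h : S → ℝ, γ₀ * lawVariance (μ 0) h ≤ dirichletForm (μ 0) (M 0) h)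
    (hgapA : ∀ k j, ∀ h : S → ℝ, γA * lawVariance (blockLaw (μ k) mode j) h
      ≤ dirichletForm (blockLaw (μ k) mode j) (restrictionChain (M k) mode) h)
    (k : Fin (K + 1)) (j : J) (N : ℕ) :
    ∑ x, tensorFun μ x * meanHitWithin (ptBareSampler (1 / 2) μ M)
        (↑(univ.filter (fun x : Fin (K + 1) → S => mode (x k) = j)) : Set (Fin (K + 1) → S)) N x
      ≤ (1 - blockMass (μ k) mode j)
          / (p * q ^ K * γA * min (δ₂ / K ^ 2) (γ₀ / (K + 1)) / (96 * (K + 1) ^ 2) * blockMass (μ k) mode j) := by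
  have ht0 : (0 : ℝ) < 1 / 2 := by norm_num
  have ht1 : (1 / 2 : ℝ) < 1 := by norm_num
  have hKr : (1 : ℝ) ≤ K := by exact_mod_cast hK
  have hP := ptBareSampler_isRowStochastic (M := M) hμ hM ht0.le ht1.le
  have hDB := ptBareSampler_detailedBalance (t := (1 / 2 : ℝ)) (M := M) hμ hMrev
  have hst := ptBareSampler_isStationary (t := (1 / 2 : ℝ)) hμ hM hMrev ht0.le ht1.le
  set c := p * q ^ K * γA * min (δ₂ / K ^ 2) (γ₀ / (K + 1)) / (96 * (K + 1) ^ 2) with hcdef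
  have hm : 0 < min (δ₂ / K ^ 2) (γ₀ / (K + 1)) := lt_min (div_pos hδ0 (by positivity)) (div_pos hγ₀ (by positivity))
  have hcpos : 0 < c := by positivity
  have hc : c ≤ spectralGap (tensorFun μ) (ptBareSampler (1 / 2) μ M) :=
    ptBareModeHalf_spectralGap_ge_of_hotGap hμ hμ1 hmode hK hM hMrev hp hp1 hq0 hq1 hδ0 hδ1 hγ₀ hγA hγA1 hpers hq hδ
      hgap0 hgapA
  have hgap : ∀ f : (Fin (K + 1) → S) → ℝ,
      c * lawVariance (tensorFun μ) f ≤ dirichletForm (tensorFun μ) (ptBareSampler (1 / 2) μ M) f := fun f =>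
    (mul_le_mul_of_nonneg_right hc (lawVariance_nonneg (fun x => (tensorFun_pos hμ x).le) f)).trans
      (LevinPeres2017_remark_13_8 (tensorFun_pos hμ) (sum_tensorFun_eq_one μ hμ1) hP hDB f)
  have hA : 0 < ∑ x ∈ univ.filter (fun x : Fin (K + 1) → S => mode (x k) = j), tensorFun μ x := by
    rw [ptBare_levelSector_mass hμ1 k j]; exact blockMass_pos (hμ k) hmode j
  have h := equilibrium_meanHitWithin_le (fun x => (tensorFun_pos hμ x).le) (sum_tensorFun_eq_one μ hμ1) hP hst hcpos
    hgap _ hA N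
  rw [ptBare_levelSector_mass hμ1 k j] at h
  rw [ptBare_levelSector_mass_compl hμ1 k j] at h
  exact h

end Tunnel

end Summit.Ventures.LatticeQCDFlow.Scaling
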